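/-
COR-CM (cell pub-hodgecm2, stage 2 of the Hodge ladder) — junction B01, leaf B01-O: the SPLIT END DISPLAY OF RECORD re-cut in
MEETING FORM over the model's own Matsushima embedding `Model.embOf` (x2 lane `CorCM/B01/FaceWedgeOverlap*.lean`, lead NAMING RULING
HOME/INBOX l.4194 (3); meeting-form twin of `CorCM/B01/FaceWedgeOverlapBypass.lean`, p291484).  KERNEL CONTENT AUTHORED by
planner-pub-hodgecm2-b01-idea-2-g19-0 (`HOME/b01/IDEA-2t-Sketch-D2.lean`, md5 6d1bf1483b1b, farm rc 0 · 0 warn · 0 sorry · trio ×4,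
2026-08-21T17:21Z; memo `HOME/b01/IDEA-2t-beta-trap-and-meeting-display.md` f9586fe518a1); brought to tree form (namespace `Model`
instead of `Model.IDEA2t`; the leaf B01-H DISCHARGED by `Transposition.Model.heckeWedge10_of_heckeFamily`, p277416, instead of a binder;
the ∃ι₁∃V-supply and `_rec` forms added) and FILED by seat prover-pub-hodgecm2-b01-x2-g3-0 (b01-x2 gen 3), 2026-08-21.
Theorems only: no `def`, no instance, no cite binder, nothing cited as a record, nothing asserted, no `sorry`; `Interfaces.lean` (C1),
the E term, `Transposition/*` and the other `CorCM/B01/*` files untouched.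
T5 (standing tribunal item, COORDINATOR RULING 2026-08-21T15:33:56Z (3)): the binder set {`hS`, `hM`} of the displays below was submitted
to pub-hodgecm2-t5-consist-1 on the exact bytes before filing (HOME/INBOX; verdict line in HOME/T5-LEDGER.md, quoted in the filing note).
FRAMING (COORDINATOR RULING 2026-08-21T11:55:35Z): HC_CM is NOT proved; B01-O is NOT proved; every displayed hypothesis below is OPEN
at a general face and inhabited by no one.
-/
import Summits.HodgeConjecture.CorCM.B01.Transposition.Item5IsolationSpansHolds
import Summits.HodgeConjecture.CorCM.B01.Transposition.Item3InnerEmbHolds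
import Summits.HodgeConjecture.CorCM.B01.Transposition.Item6HoldsRec
import Summits.HodgeConjecture.CorCM.FacePeriodWitnesses
import HarnessLib

/-!
# B01 ⇐ B01-S ∧ hM: the split end display in MEETING form over `Model.embOf` (no `cover`, no (β), item (iii) discharged)

The END DISPLAY OF RECORD of the transposition lane, `Model.hc_cm_of_supply_of_dictionary_of_eq`
(`Transposition/Item6HoldsRec.lean`:205), and its B01 twin `Model.perLFace_of_PerL_of_supply_dictionary`
(`CorCM/B01/FaceWedgeOverlapBypass.lean`, p291484) take, besides the supply `hS` (B01-S ∕ ITEM6-SPLIT S2), ONE dictionary binder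
`hD` = item (iii)'s `(HG, emb, cover)` with the clauses (α) saturated coupling, (β) `emb Γ' (cover^* x) = emb Γ x`, (γ) Petersson = cup.
FINDING OF RECORD (b01-idea-2 g19, IDEA-2t; stage-1 hazard C1, `Transposition/Item3Automorphic.lean` header; `FaceWedgeMeetJointMeeting.lean`
header): (β) is FALSE for the tree's only model embedding `Model.embOf` (`Transposition/Item3EmbOf.lean`: extension by zero from the
principal `K_Γ`-piece) as soon as the principal piece splits, and the tree's item-(iii) construction delivers `levelMeet`, never
`emb_cover` — so `hD`, though consistent, is NOT inhabitable at `embOf`: every display binding (β) is «E2-shaped».  CAVEAT OF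
RECORD FOR THE x2 LANE: this applies to BOTH earlier x2 files — `FaceWedgeOverlapBypass.lean` (p291484, via `hD`) and
`FaceWedgeOverlapDescent.lean` (p290964, which uses (β) essentially: pull-back to a common level in
`Universe.exists_pullC_cover_mem_wedgeSpan_of_coupling_of_descent`); both stay correct and consistent, and both need an index-normalised
(`K_Γ`-equivariant, classical Petersson) dictionary — which no seat constructs — to be instantiated on `U_rec`.

THIS FILE re-cuts the SPLIT display in MEETING form (PKG END STATE `thm44_of_realisation₂`, `HodgeCM/Model/EndStateMeet.lean`:200–222 =
tree `Transposition.IsolationSpans.periodNV_ofSetting_meet`, `Item5IsolationSpansHolds.lean`:281) with `HG := Lp ℂ 2 V.autMeasure` and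
`emb := Model.embOf` PLUGGED IN.  Item (iii) then contributes NO binder: `inner_emb := Model.embOf_inner_emb` and injectivity on `F²`
`:= Model.embOf_ne_zero_of_two_lt` (D2, `Item3InnerEmbHolds.lean`, p290113); the leaf B01-H is the THEOREM
`Transposition.Model.heckeWedge10_of_heckeFamily` (p277416); Hodge–Riemann (2,0), the universe facts and (on `U_rec`) Hom-fullness are
tree theorems.  What is displayed:
* `hS` — B01-S of record `U.FaceSupply` (`B01/FaceInputsSplit.lean`:50; = what the pinning lane's `Item6SupplyPinned*` junctions
  conclude), or its ∃ι₁∃V form (token-identical to `Item6HoldsRec.lean`:208–210);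
* `hM` — `∀ ι₁` admissible `∀ V` (V-uniform, typed like `hD`), purely theta-side, over the model's own `L²([U(V)], autMeasure V)`:
  carrier types + instances, an isolation setting `S : Perl34.IsolationSetting H (Lp ℂ 2 V.autMeasure) CG G SK SigIdx SigIdxG` [(v-S)],
  `gen12MeetSat` = C5′ at the SATURATED (12)-sets `U_{ψ₀} × U_{ψ₁}` relative to `embOf` [(v-g′) at saturation], and `real34Meet` = C6′
  verbatim from `periodNV_ofSetting_meet` at `emb := embOf` [(v-r′)].
REMOVED versus `hD`: the data `HG`, `emb`, `cover` and the clauses (α), (β), (γ).  ADDED: `S`, `gen12MeetSat`, `real34Meet`.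
PKG discharge tags (tr-prover-5, HOME/INBOX l.4241; `HodgeCM/Model/EndStateMeet.lean`): (v-S) [GENERAL, `nonempty_thetaRealisation₂_at`
:353]; C6′ [GENERAL, `Real34MeetAt` :245]; C5′ at PINNED theta sets [GENERAL, `Gen12MeetAt` :238].  **C5′ at SATURATED sets is NOT in the
package**: it is the exhaustion-flavoured input (E) — every face-type `U_ψ`-class is a finite sum of theta lifts indexed by `S`, and
wedge-functions of theta lifts lie in `S₁₂` (print level: Rogawski 1990 §13.3, Gelbart–Rogawski 1991 §3; cite-level, typed by nobody,
UN-OWNED) — the same residual (E1) as `CorCM/B01/FaceWedgeOverlapOfExhaustion.lean` (p291780), here in meeting currency.  CAVEAT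
(idea-2 TRAP T2; own-b01 (O-J), HOME/INBOX l.4212): `hM` offers ONE setting `S` per context `(F, f, ι₁, V)`, so `gen12MeetSat` also asks
that this one `S₁₂` meet the (12)-wedge-functions of EVERY seesaw configuration class contributing to `U_{ψ₀}(Γ) × U_{ψ₁}(Γ)` — at `U_rec`
that needs a single class per context or a direct-sum instance of `Perl34.IsolationSetting` (not examined); the PER-PAIR alternative (one
setting per pair of line families carrying a non-zero theta wedge, exhaustion (E) an explicit binder) is the sequel
`CorCM/B01/FaceWedgeOverlapOfExhaustionMeeting.lean` of this lane, built on the Θ-free `hc_cm_of_settingMeet_embOf` below.  So the three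
(β)-free end displays of the evening and their ONE extra theta-side cost beyond {(v-S), C6′, pinned C5′}: JOINT
(`Model.hc_cm_of_jointThetaPin_meeting_rec`, `FaceWedgeMeetJointMeeting.lean`, p292271): (O-J) `TranslateClosed`; SPLIT-saturated (this
file, `hc_cm_of_supply_of_settingMeetSat_embOf[_rec]`): (E); Θ-free (`hc_cm_of_settingMeet_embOf`): the inhabitant chooses.

## Contents (namespace `Summit.HodgeConjecture.CorCM.Model`)
* `periodNV_of_settingMeet_embOf` — `PeriodNV` at a context `(L, ι₁, V; K, Ψ, σ)`, `2 < [L:ℚ]`, from an isolation setting over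
  `Lp ℂ 2 V.autMeasure`, theta sets `Θ ⊆ U_Ψ`, ONE non-zero cohomological theta (12)-wedge, C5′/C6′ for `embOf` (Θ FREE).
* `hc_cm_of_settingMeet_embOf` — `HC_CM` on every model universe (+ `hR`) from one such quintuple per face (Θ-free common
  generalisation of the joint and split displays).
* `hc_cm_of_exists_supply_of_settingMeetSat_embOf` — SPLIT display, ∃ι₁∃V supply + `hM`.
* `hc_cm_of_supply_of_settingMeetSat_embOf` — SPLIT display, `hS : U.FaceSupply` (B01-S of record) + `hM`.
* `hc_cm_of_supply_of_settingMeetSat_embOf_rec` — the same on the universe OF RECORD (`let U := U_rec`): exactly TWO hypotheses.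
HC_CM is NOT proved: `hS`, `hM`, `h` are inhabited by no one; nothing here is a row change (count-neutral alternative reading).
-/

noncomputable section

set_option autoImplicit false

open scoped TensorProduct InnerProductSpace
open MeasureTheory
open Literature.AlgebraicGeometry.HodgeTheory
open Literature.NumberTheory.Automorphic
open Literature.NumberTheory.Automorphic.PicardCM

namespace Summit.HodgeConjecture.CorCM

open Literature.AlgebraicGeometry.Motives (CMType HodgeStructure)
open Literature.AlgebraicGeometry.Motives.HodgeStructure (conj)
open Prior.Perl34File (Perl34.IsolationSetting)
open Prior.Perl34File.Perl34

namespace Model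


/-! ## §1  `PeriodNV` at a face context from the meeting-form theta inputs, `emb := Model.embOf` (item (iii) binder-free) -/

/-- **PKG END STATE (`thm44_of_realisation₂`, `Model/EndStateMeet.lean`:200–222) on the model universe with the adelic Matsushima
embedding `embOf` PLUGGED IN**: for `U := universeOf hHD hI hU h₃`, a CM field `L` with `2 < [L:ℚ]`, `(ι₁, V)`, target data
`(K, Ψ, σ)`: an isolation setting `S` over `HG := L²([U(V)], autMeasure V)`, theta sets `Θ` typed by `Theta_sub`, ONE cohomological
theta (12)-wedge `ω₁ ∪ ω₂ ≠ 0`, and the meeting-form Lemma-3.5 inputs C5′ `gen12Meet`, C6′ `real34Meet` for `embOf` imply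
`U.PeriodNV ι₁ V K Ψ σ`.  Item (iii) enters only through the LANDED theorems `Model.embOf_inner_emb` (Petersson = cup, D2) and
`Model.embOf_ne_zero_of_two_lt` (injectivity on `F²`, Hodge–Riemann (2,0) a tree theorem); NO `cover`, NO `emb_cover`, NO
`levelMeet`.  [folklore] -/
theorem periodNV_of_settingMeet_embOf (hHD : exists_isReal_hodgeModel) (hI : hodgePQ_independent_of_hodgeModel)
    (hU : BallQuotientUniformisedDatum) (h₃ : CMAbelianVarietyRealised)
    {L : CMField} (hL : 2 < Module.finrank ℚ L) {ι₁ : L →+* ℂ} (V : HermSpace3 L ι₁)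
    {K : CMField} {Ψ : Fin 4 → CMType K} {σ : K →+* ℂ}
    {H CG G SK SigIdx SigIdxG : Type*}
    [NormedAddCommGroup H] [InnerProductSpace ℂ H] [CompleteSpace H]
    [NormedAddCommGroup CG] [NormedSpace ℂ CG] [Group G] [TopologicalSpace G] [TopologicalSpace SK]
    (S : Perl34.IsolationSetting H (Lp ℂ 2 V.autMeasure) CG G SK SigIdx SigIdxG)
    {Θ : Fin 4 → ∀ Γ : Level V, Set ((universeOf hHD hI hU h₃).CohC ((universeOf hHD hI hU h₃).pms L ι₁ V Γ) 1)}
    (Theta_sub : ∀ (i : Fin 4) (Γ : Level V), Θ i Γ ⊆ (universeOf hHD hI hU h₃).Uiso Γ K (Ψ i) σ)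
    (wedge : ∃ (Γ : Level V), ∃ ω₁ ∈ Θ 0 Γ, ∃ ω₂ ∈ Θ 1 Γ,
      (universeOf hHD hI hU h₃).cup2C ((universeOf hHD hI hU h₃).pms L ι₁ V Γ) 1 ω₁ ω₂ ≠ 0)
    (gen12Meet : ∀ (Γ : Level V) (ω₁ ω₂ : (universeOf hHD hI hU h₃).CohC ((universeOf hHD hI hU h₃).pms L ι₁ V Γ) 1),
      ω₁ ∈ Θ 0 Γ → ω₂ ∈ Θ 1 Γ →
        embOf hHD hI hU h₃ Γ ((universeOf hHD hI hU h₃).cup2C ((universeOf hHD hI hU h₃).pms L ι₁ V Γ) 1 ω₁ ω₂) ≠ 0 →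
          ∃ u ∈ S.t12.S12,
            ⟪embOf hHD hI hU h₃ Γ ((universeOf hHD hI hU h₃).cup2C ((universeOf hHD hI hU h₃).pms L ι₁ V Γ) 1 ω₁ ω₂), u⟫_ℂ ≠ 0)
    (real34Meet : ∀ χ : S.t34.X, S.t34.allowed χ → ∀ (Φ : SK) (Γ₁ : Level V)
      (ω₁ ω₂ : (universeOf hHD hI hU h₃).CohC ((universeOf hHD hI hU h₃).pms L ι₁ V Γ₁) 1),
      ω₁ ∈ (universeOf hHD hI hU h₃).Uiso Γ₁ K (Ψ 0) σ → ω₂ ∈ (universeOf hHD hI hU h₃).Uiso Γ₁ K (Ψ 1) σ →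
        ⟪embOf hHD hI hU h₃ Γ₁ ((universeOf hHD hI hU h₃).cup2C ((universeOf hHD hI hU h₃).pms L ι₁ V Γ₁) 1 ω₁ ω₂),
          S.t34.ϑ χ Φ⟫_ℂ ≠ 0 →
          ∃ (Γ : Level V) (ω : Fin 4 → (universeOf hHD hI hU h₃).CohC ((universeOf hHD hI hU h₃).pms L ι₁ V Γ) 1),
            (∀ i, ω i ∈ (universeOf hHD hI hU h₃).Uiso Γ K (Ψ i) σ) ∧
              ⟪embOf hHD hI hU h₃ Γ ((universeOf hHD hI hU h₃).cup2C ((universeOf hHD hI hU h₃).pms L ι₁ V Γ) 1 (ω 2) (ω 3)),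
                embOf hHD hI hU h₃ Γ ((universeOf hHD hI hU h₃).cup2C ((universeOf hHD hI hU h₃).pms L ι₁ V Γ) 1 (ω 0) (ω 1))⟫_ℂ
                ≠ 0) :
    (universeOf hHD hI hU h₃).PeriodNV ι₁ V K Ψ σ := by
  -- item (vi)'s line field FOR `embOf`: the cohomological wedge is non-zero in `L²` (D2 + Hodge–Riemann (2,0))
  obtain ⟨Γ, ω₁, hω₁, ω₂, hω₂, hne⟩ := wedge
  have hF : (universeOf hHD hI hU h₃).cup2C ((universeOf hHD hI hU h₃).pms L ι₁ V Γ) 1 ω₁ ω₂ ∈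
      ((universeOf hHD hI hU h₃).hodge ((universeOf hHD hI hU h₃).pms L ι₁ V Γ) 2).F 2 :=
    Universe.cup2C_mem_F_two_of_Uiso (universeOf_fact_pull_hodge hHD hI hU h₃) (universeOf_fact_cup2_hodge hHD hI hU h₃)
      Γ K (Ψ 0) (Ψ 1) σ (Theta_sub 0 Γ hω₁) (Theta_sub 1 Γ hω₂)
  have hlf : ∃ (Γ : Level V), ∃ ω₁ ∈ Θ 0 Γ, ∃ ω₂ ∈ Θ 1 Γ,
      embOf hHD hI hU h₃ Γ ((universeOf hHD hI hU h₃).cup2C ((universeOf hHD hI hU h₃).pms L ι₁ V Γ) 1 ω₁ ω₂) ≠ 0 :=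
    ⟨Γ, ω₁, hω₁, ω₂, hω₂, embOf_ne_zero_of_two_lt hHD hI hU h₃ hL Γ hF hne⟩
  exact Transposition.IsolationSpans.periodNV_ofSetting_meet (universeOf_fact_pull_hodge hHD hI hU h₃)
    (universeOf_fact_cup2_hodge hHD hI hU h₃) S Theta_sub hlf gen12Meet real34Meet (embOf_inner_emb hHD hI hU h₃ hL V)


/-! ## §2  The Θ-free MEETING-form display on the model universe: `HC_CM` with item (iii) discharged BY NAME -/

/-- **END DISPLAY, MEETING FORM, `emb := Model.embOf`** (compare `Model.hc_cm_of_supply_of_dictionary_of_eq`, `Item6HoldsRec.lean`:205,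
whose `hD` binds the data `(HG, emb, cover)` and the clauses (β) `emb_cover`, (γ) `inner_emb`): on every model universe
`picardCMUniverse hHD hI h₁ h₃`, with Deligne–Milne 1982 Thm 6.20 (`hR`), `HC_CM` follows from — per Galois CM field `F` of degree
`≥ 6` and face `f`, at ONE admissible `ι₁` and ONE `V` — an isolation setting `S` over `L²([U(V)], autMeasure V)`, theta sets
`Θ ⊆ U_Ψ` (`Theta_sub`), ONE non-zero cohomological theta (12)-wedge, and C5′/C6′ (`gen12Meet`, `real34Meet`) for `embOf`.
`HG`, `emb`, `inner_emb` are NOT binders (D1 `Model.embOf`, D2 `Model.embOf_inner_emb`, LANDED); (β) `emb_cover` and `cover` do not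
occur.  Composition: `hc_cm_of_exists_facePeriod` ∘ `periodNV_of_settingMeet_embOf` (σ := ι₁).  HC_CM is NOT proved: `h` is
inhabited by no one. [folklore] -/
theorem hc_cm_of_settingMeet_embOf (hHD : exists_isReal_hodgeModel) (hI : hodgePQ_independent_of_hodgeModel)
    (h₁ : BallQuotientUniformised) (h₃ : CMAbelianVarietyRealised) (hR : DeligneMilne1982_Thm_6_20_full)
    (h : ∀ (F : CMField), IsGalois ℚ F → 6 ≤ Module.finrank ℚ F → ∀ f : Face F,
      ∃ ι₁ : F →+* ℂ, f.Admissible ι₁ ∧ ∃ (V : HermSpace3 F ι₁)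
        (H CG G SK SigIdx SigIdxG : Type) (_ : NormedAddCommGroup H) (_ : InnerProductSpace ℂ H) (_ : CompleteSpace H)
        (_ : NormedAddCommGroup CG) (_ : NormedSpace ℂ CG) (_ : Group G) (_ : TopologicalSpace G) (_ : TopologicalSpace SK)
        (S : Perl34.IsolationSetting H (Lp ℂ 2 V.autMeasure) CG G SK SigIdx SigIdxG)
        (Θ : Fin 4 → ∀ Γ : Level V,
          Set ((picardCMUniverse hHD hI h₁ h₃).CohC ((picardCMUniverse hHD hI h₁ h₃).pms F ι₁ V Γ) 1)),
        (∀ (i : Fin 4) (Γ : Level V), Θ i Γ ⊆ (picardCMUniverse hHD hI h₁ h₃).Uiso Γ F (f.psi i) ι₁) ∧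
        (∃ (Γ : Level V), ∃ ω₁ ∈ Θ 0 Γ, ∃ ω₂ ∈ Θ 1 Γ,
          (picardCMUniverse hHD hI h₁ h₃).cup2C ((picardCMUniverse hHD hI h₁ h₃).pms F ι₁ V Γ) 1 ω₁ ω₂ ≠ 0) ∧
        (∀ (Γ : Level V) (ω₁ ω₂ : (picardCMUniverse hHD hI h₁ h₃).CohC ((picardCMUniverse hHD hI h₁ h₃).pms F ι₁ V Γ) 1),
          ω₁ ∈ Θ 0 Γ → ω₂ ∈ Θ 1 Γ →
            embOf hHD hI (ballQuotientUniformisedDatum_of h₁) h₃ Γ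
                ((picardCMUniverse hHD hI h₁ h₃).cup2C ((picardCMUniverse hHD hI h₁ h₃).pms F ι₁ V Γ) 1 ω₁ ω₂) ≠ 0 →
              ∃ u ∈ S.t12.S12,
                ⟪embOf hHD hI (ballQuotientUniformisedDatum_of h₁) h₃ Γ
                    ((picardCMUniverse hHD hI h₁ h₃).cup2C ((picardCMUniverse hHD hI h₁ h₃).pms F ι₁ V Γ) 1 ω₁ ω₂), u⟫_ℂ ≠ 0) ∧
        (∀ χ : S.t34.X, S.t34.allowed χ → ∀ (Φ : SK) (Γ₁ : Level V)
          (ω₁ ω₂ : (picardCMUniverse hHD hI h₁ h₃).CohC ((picardCMUniverse hHD hI h₁ h₃).pms F ι₁ V Γ₁) 1),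
          ω₁ ∈ (picardCMUniverse hHD hI h₁ h₃).Uiso Γ₁ F (f.psi 0) ι₁ →
          ω₂ ∈ (picardCMUniverse hHD hI h₁ h₃).Uiso Γ₁ F (f.psi 1) ι₁ →
            ⟪embOf hHD hI (ballQuotientUniformisedDatum_of h₁) h₃ Γ₁
                ((picardCMUniverse hHD hI h₁ h₃).cup2C ((picardCMUniverse hHD hI h₁ h₃).pms F ι₁ V Γ₁) 1 ω₁ ω₂),
              S.t34.ϑ χ Φ⟫_ℂ ≠ 0 →
              ∃ (Γ : Level V) (ω : Fin 4 → (picardCMUniverse hHD hI h₁ h₃).CohC ((picardCMUniverse hHD hI h₁ h₃).pms F ι₁ V Γ) 1),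
                (∀ i, ω i ∈ (picardCMUniverse hHD hI h₁ h₃).Uiso Γ F (f.psi i) ι₁) ∧
                  ⟪embOf hHD hI (ballQuotientUniformisedDatum_of h₁) h₃ Γ
                      ((picardCMUniverse hHD hI h₁ h₃).cup2C ((picardCMUniverse hHD hI h₁ h₃).pms F ι₁ V Γ) 1 (ω 2) (ω 3)),
                    embOf hHD hI (ballQuotientUniformisedDatum_of h₁) h₃ Γ
                      ((picardCMUniverse hHD hI h₁ h₃).cup2C ((picardCMUniverse hHD hI h₁ h₃).pms F ι₁ V Γ) 1 (ω 0) (ω 1))⟫_ℂ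
                    ≠ 0)) :
    HC_CM := by
  refine hc_cm_of_exists_facePeriod hHD hI h₁ h₃ ?_ hR
  intro F hG h6 f
  obtain ⟨ι₁, hι, V, H, CG, G, SK, SigIdx, SigIdxG, _, _, _, _, _, _, _, _, S, Θ, hsub, hw, hg, hr⟩ := h F hG h6 f
  have hL : 2 < Module.finrank ℚ F := by omega
  exact ⟨ι₁, hι, V, ι₁, periodNV_of_settingMeet_embOf hHD hI (ballQuotientUniformisedDatum_of h₁) h₃ hL V S hsub hw hg hr⟩

/-! ## §3  The SPLIT END DISPLAY re-cut in MEETING form: supply (B01-S ∕ S2) + `hM` (theta side at SATURATED sets) — no `hD` -/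

/-- **SPLIT END DISPLAY, MEETING FORM, ∃ι₁∃V SUPPLY** (E3-analogue of `Model.hc_cm_of_supply_of_dictionary_of_eq`,
`Item6HoldsRec.lean`:205, whose `hS` is token-identical to the one here): keep the supply `hS` (S2: per face, at SOME admissible `ι₁`,
SOME `V`, one level with non-zero classes of `U_{ψ₀}`, `U_{ψ₁}`) and REPLACE `hD` by the `∀ ι₁ ∀ V`-typed theta-side binder `hM`: carrier
types + instances, an isolation setting `S` over `L²([U(V)], autMeasure V)`, C5′ at the SATURATED (12)-sets (`gen12MeetSat`) and C6′
(`real34Meet`) relative to `Model.embOf`.  B01-H is the theorem `Transposition.Model.heckeWedge10_of_heckeFamily` (inside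
`faceThetaSupplyWedgeExists_iff_exists_supply'`); item (iii) is `Model.embOf` + D2; `HG`, `emb`, `cover`, (α), (β), (γ) do not occur;
the joint pin (O-J) is vacuous at saturated sets.  Proof: a non-zero cohomological (12)-wedge of `U_Ψ`-classes at some admissible
`(ι₁, V)` (`Transposition.exists_lineField_witness`), saturated theta sets `Θ i Γ := U_{ψ_i}(Γ)` (`Theta_sub` by `rfl`), then
`periodNV_of_settingMeet_embOf` and `hc_cm_of_exists_facePeriod` (σ := ι₁).  COST beyond the package: C5′ at saturated sets = (E),
un-owned.  HC_CM is NOT proved: `hS`, `hM` are inhabited by no one. [folklore] -/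
theorem hc_cm_of_exists_supply_of_settingMeetSat_embOf (hHD : exists_isReal_hodgeModel) (hI : hodgePQ_independent_of_hodgeModel)
    (h₁ : BallQuotientUniformised) (h₃ : CMAbelianVarietyRealised) (hR : DeligneMilne1982_Thm_6_20_full)
    (hS : ∀ (F : CMField), IsGalois ℚ F → 6 ≤ Module.finrank ℚ F → ∀ f : Face F,
      ∃ ι₁ : F →+* ℂ, f.Admissible ι₁ ∧ ∃ (V : HermSpace3 F ι₁) (Γ : Level V)
        (ω₀ ω₁ : (picardCMUniverse hHD hI h₁ h₃).CohC ((picardCMUniverse hHD hI h₁ h₃).pms F ι₁ V Γ) 1),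
        ω₀ ∈ (picardCMUniverse hHD hI h₁ h₃).Uiso Γ F (f.psi 0) ι₁ ∧
          ω₁ ∈ (picardCMUniverse hHD hI h₁ h₃).Uiso Γ F (f.psi 1) ι₁ ∧ ω₀ ≠ 0 ∧ ω₁ ≠ 0)
    (hM : ∀ (F : CMField), IsGalois ℚ F → 6 ≤ Module.finrank ℚ F → ∀ (f : Face F) (ι₁ : F →+* ℂ), f.Admissible ι₁ →
      ∀ V : HermSpace3 F ι₁,
      ∃ (H CG G SK SigIdx SigIdxG : Type) (_ : NormedAddCommGroup H) (_ : InnerProductSpace ℂ H) (_ : CompleteSpace H)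
        (_ : NormedAddCommGroup CG) (_ : NormedSpace ℂ CG) (_ : Group G) (_ : TopologicalSpace G) (_ : TopologicalSpace SK)
        (S : Perl34.IsolationSetting H (Lp ℂ 2 V.autMeasure) CG G SK SigIdx SigIdxG),
        (∀ (Γ : Level V) (ω₁ ω₂ : (picardCMUniverse hHD hI h₁ h₃).CohC ((picardCMUniverse hHD hI h₁ h₃).pms F ι₁ V Γ) 1),
          ω₁ ∈ (picardCMUniverse hHD hI h₁ h₃).Uiso Γ F (f.psi 0) ι₁ → ω₂ ∈ (picardCMUniverse hHD hI h₁ h₃).Uiso Γ F (f.psi 1) ι₁ →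
            embOf hHD hI (ballQuotientUniformisedDatum_of h₁) h₃ Γ
                ((picardCMUniverse hHD hI h₁ h₃).cup2C ((picardCMUniverse hHD hI h₁ h₃).pms F ι₁ V Γ) 1 ω₁ ω₂) ≠ 0 →
              ∃ u ∈ S.t12.S12,
                ⟪embOf hHD hI (ballQuotientUniformisedDatum_of h₁) h₃ Γ
                    ((picardCMUniverse hHD hI h₁ h₃).cup2C ((picardCMUniverse hHD hI h₁ h₃).pms F ι₁ V Γ) 1 ω₁ ω₂), u⟫_ℂ ≠ 0) ∧
        (∀ χ : S.t34.X, S.t34.allowed χ → ∀ (Φ : SK) (Γ₁ : Level V)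
          (ω₁ ω₂ : (picardCMUniverse hHD hI h₁ h₃).CohC ((picardCMUniverse hHD hI h₁ h₃).pms F ι₁ V Γ₁) 1),
          ω₁ ∈ (picardCMUniverse hHD hI h₁ h₃).Uiso Γ₁ F (f.psi 0) ι₁ →
          ω₂ ∈ (picardCMUniverse hHD hI h₁ h₃).Uiso Γ₁ F (f.psi 1) ι₁ →
            ⟪embOf hHD hI (ballQuotientUniformisedDatum_of h₁) h₃ Γ₁
                ((picardCMUniverse hHD hI h₁ h₃).cup2C ((picardCMUniverse hHD hI h₁ h₃).pms F ι₁ V Γ₁) 1 ω₁ ω₂),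
              S.t34.ϑ χ Φ⟫_ℂ ≠ 0 →
              ∃ (Γ : Level V) (ω : Fin 4 → (picardCMUniverse hHD hI h₁ h₃).CohC ((picardCMUniverse hHD hI h₁ h₃).pms F ι₁ V Γ) 1),
                (∀ i, ω i ∈ (picardCMUniverse hHD hI h₁ h₃).Uiso Γ F (f.psi i) ι₁) ∧
                  ⟪embOf hHD hI (ballQuotientUniformisedDatum_of h₁) h₃ Γ
                      ((picardCMUniverse hHD hI h₁ h₃).cup2C ((picardCMUniverse hHD hI h₁ h₃).pms F ι₁ V Γ) 1 (ω 2) (ω 3)),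
                    embOf hHD hI (ballQuotientUniformisedDatum_of h₁) h₃ Γ
                      ((picardCMUniverse hHD hI h₁ h₃).cup2C ((picardCMUniverse hHD hI h₁ h₃).pms F ι₁ V Γ) 1 (ω 0) (ω 1))⟫_ℂ
                    ≠ 0)) :
    HC_CM := by
  refine hc_cm_of_exists_facePeriod hHD hI h₁ h₃ ?_ hR
  intro F hG h6 f
  obtain ⟨ι₁, hι, V, Γ, ω₀, ω₁, h0, h1, hne⟩ := Transposition.exists_lineField_witness
    ((faceThetaSupplyWedgeExists_iff_exists_supply' hHD hI h₁ h₃).mpr hS) F hG h6 f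
  obtain ⟨H, CG, G, SK, SigIdx, SigIdxG, _, _, _, _, _, _, _, _, S, hg, hr⟩ := hM F hG h6 f ι₁ hι V
  have hL : 2 < Module.finrank ℚ F := by omega
  exact ⟨ι₁, hι, V, ι₁, periodNV_of_settingMeet_embOf hHD hI (ballQuotientUniformisedDatum_of h₁) h₃ hL V S
    (Θ := fun i Γ' ↦ SetLike.coe ((universeOf hHD hI (ballQuotientUniformisedDatum_of h₁) h₃).Uiso Γ' F (f.psi i) ι₁))
    (fun _ _ ↦ Set.Subset.rfl) ⟨Γ, ω₀, h0, ω₁, h1, hne⟩ hg hr⟩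

/-- **SPLIT END DISPLAY, MEETING FORM, B01-S OF RECORD**: the same with the supply in the displayed `∀ ι₁ ∀ V` shape
`U.FaceSupply` (`B01/FaceInputsSplit.lean`:50) — the conclusion of the pinning lane's junctions (`Model.faceSupply_of_…`,
`Transposition/Item6SupplyReach.lean` / `Item6SupplyPinned*`), so that those compose with THIS display BY NAME and the binders after
composition are the pin binders + `hM` (no `hD`, no (β)).  Via `faceThetaSupplyWedgeExists_of_faceSupply'` (B01-H discharged inside) and
`Transposition.exists_supply_witness`.  HC_CM is NOT proved: `hS`, `hM` are inhabited by no one. [folklore] -/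
theorem hc_cm_of_supply_of_settingMeetSat_embOf (hHD : exists_isReal_hodgeModel) (hI : hodgePQ_independent_of_hodgeModel)
    (h₁ : BallQuotientUniformised) (h₃ : CMAbelianVarietyRealised) (hR : DeligneMilne1982_Thm_6_20_full)
    (hS : (picardCMUniverse hHD hI h₁ h₃).FaceSupply)
    (hM : ∀ (F : CMField), IsGalois ℚ F → 6 ≤ Module.finrank ℚ F → ∀ (f : Face F) (ι₁ : F →+* ℂ), f.Admissible ι₁ →
      ∀ V : HermSpace3 F ι₁,
      ∃ (H CG G SK SigIdx SigIdxG : Type) (_ : NormedAddCommGroup H) (_ : InnerProductSpace ℂ H) (_ : CompleteSpace H)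
        (_ : NormedAddCommGroup CG) (_ : NormedSpace ℂ CG) (_ : Group G) (_ : TopologicalSpace G) (_ : TopologicalSpace SK)
        (S : Perl34.IsolationSetting H (Lp ℂ 2 V.autMeasure) CG G SK SigIdx SigIdxG),
        (∀ (Γ : Level V) (ω₁ ω₂ : (picardCMUniverse hHD hI h₁ h₃).CohC ((picardCMUniverse hHD hI h₁ h₃).pms F ι₁ V Γ) 1),
          ω₁ ∈ (picardCMUniverse hHD hI h₁ h₃).Uiso Γ F (f.psi 0) ι₁ → ω₂ ∈ (picardCMUniverse hHD hI h₁ h₃).Uiso Γ F (f.psi 1) ι₁ →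
            embOf hHD hI (ballQuotientUniformisedDatum_of h₁) h₃ Γ
                ((picardCMUniverse hHD hI h₁ h₃).cup2C ((picardCMUniverse hHD hI h₁ h₃).pms F ι₁ V Γ) 1 ω₁ ω₂) ≠ 0 →
              ∃ u ∈ S.t12.S12,
                ⟪embOf hHD hI (ballQuotientUniformisedDatum_of h₁) h₃ Γ
                    ((picardCMUniverse hHD hI h₁ h₃).cup2C ((picardCMUniverse hHD hI h₁ h₃).pms F ι₁ V Γ) 1 ω₁ ω₂), u⟫_ℂ ≠ 0) ∧
        (∀ χ : S.t34.X, S.t34.allowed χ → ∀ (Φ : SK) (Γ₁ : Level V)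
          (ω₁ ω₂ : (picardCMUniverse hHD hI h₁ h₃).CohC ((picardCMUniverse hHD hI h₁ h₃).pms F ι₁ V Γ₁) 1),
          ω₁ ∈ (picardCMUniverse hHD hI h₁ h₃).Uiso Γ₁ F (f.psi 0) ι₁ →
          ω₂ ∈ (picardCMUniverse hHD hI h₁ h₃).Uiso Γ₁ F (f.psi 1) ι₁ →
            ⟪embOf hHD hI (ballQuotientUniformisedDatum_of h₁) h₃ Γ₁
                ((picardCMUniverse hHD hI h₁ h₃).cup2C ((picardCMUniverse hHD hI h₁ h₃).pms F ι₁ V Γ₁) 1 ω₁ ω₂),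
              S.t34.ϑ χ Φ⟫_ℂ ≠ 0 →
              ∃ (Γ : Level V) (ω : Fin 4 → (picardCMUniverse hHD hI h₁ h₃).CohC ((picardCMUniverse hHD hI h₁ h₃).pms F ι₁ V Γ) 1),
                (∀ i, ω i ∈ (picardCMUniverse hHD hI h₁ h₃).Uiso Γ F (f.psi i) ι₁) ∧
                  ⟪embOf hHD hI (ballQuotientUniformisedDatum_of h₁) h₃ Γ
                      ((picardCMUniverse hHD hI h₁ h₃).cup2C ((picardCMUniverse hHD hI h₁ h₃).pms F ι₁ V Γ) 1 (ω 2) (ω 3)),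
                    embOf hHD hI (ballQuotientUniformisedDatum_of h₁) h₃ Γ
                      ((picardCMUniverse hHD hI h₁ h₃).cup2C ((picardCMUniverse hHD hI h₁ h₃).pms F ι₁ V Γ) 1 (ω 0) (ω 1))⟫_ℂ
                    ≠ 0)) :
    HC_CM :=
  hc_cm_of_exists_supply_of_settingMeetSat_embOf hHD hI h₁ h₃ hR
    (Transposition.exists_supply_witness (faceThetaSupplyWedgeExists_of_faceSupply' hHD hI h₁ h₃ hS)) hM

/-! ## §4  The universe of record -/

/-- **The SPLIT meeting-form display on the universe OF RECORD** (the four `_holds` data and `deligneMilne1982_Thm_6_20_full_holds`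
plugged in; `let U := U_rec`, `let hU := ballQuotientUniformisedDatum_of ballQuotientUniformised_holds` for legibility): `HC_CM` from
EXACTLY TWO displayed hypotheses — B01-S of record `U.FaceSupply` and the theta-side meeting binder `hM` over `Model.embOf`.  Compare
`Model.hc_cm_of_supply_of_dictionary_of_eq` (`hS`, `hD`): here no `HG`/`emb`/`cover` data and no clause (α)/(β)/(γ).
HC_CM is NOT proved: both hypotheses are open at a general face. [folklore] -/
theorem hc_cm_of_supply_of_settingMeetSat_embOf_rec :
    let U := picardCMUniverse exists_isReal_hodgeModel_holds hodgePQ_independent_of_hodgeModel_holds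
      BallQuotient.ballQuotientUniformised_holds cmAbelianVarietyRealised_holds
    let hU := ballQuotientUniformisedDatum_of BallQuotient.ballQuotientUniformised_holds
    U.FaceSupply →
    (∀ (F : CMField), IsGalois ℚ F → 6 ≤ Module.finrank ℚ F → ∀ (f : Face F) (ι₁ : F →+* ℂ), f.Admissible ι₁ →
      ∀ V : HermSpace3 F ι₁,
      ∃ (H CG G SK SigIdx SigIdxG : Type) (_ : NormedAddCommGroup H) (_ : InnerProductSpace ℂ H) (_ : CompleteSpace H)
        (_ : NormedAddCommGroup CG) (_ : NormedSpace ℂ CG) (_ : Group G) (_ : TopologicalSpace G) (_ : TopologicalSpace SK)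
        (S : Perl34.IsolationSetting H (Lp ℂ 2 V.autMeasure) CG G SK SigIdx SigIdxG),
        (∀ (Γ : Level V) (ω₁ ω₂ : U.CohC (U.pms F ι₁ V Γ) 1),
          ω₁ ∈ U.Uiso Γ F (f.psi 0) ι₁ → ω₂ ∈ U.Uiso Γ F (f.psi 1) ι₁ →
            embOf exists_isReal_hodgeModel_holds hodgePQ_independent_of_hodgeModel_holds hU cmAbelianVarietyRealised_holds Γ
                (U.cup2C (U.pms F ι₁ V Γ) 1 ω₁ ω₂) ≠ 0 →
              ∃ u ∈ S.t12.S12,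
                ⟪embOf exists_isReal_hodgeModel_holds hodgePQ_independent_of_hodgeModel_holds hU cmAbelianVarietyRealised_holds Γ
                    (U.cup2C (U.pms F ι₁ V Γ) 1 ω₁ ω₂), u⟫_ℂ ≠ 0) ∧
        (∀ χ : S.t34.X, S.t34.allowed χ → ∀ (Φ : SK) (Γ₁ : Level V)
          (ω₁ ω₂ : U.CohC (U.pms F ι₁ V Γ₁) 1),
          ω₁ ∈ U.Uiso Γ₁ F (f.psi 0) ι₁ →
          ω₂ ∈ U.Uiso Γ₁ F (f.psi 1) ι₁ →
            ⟪embOf exists_isReal_hodgeModel_holds hodgePQ_independent_of_hodgeModel_holds hU cmAbelianVarietyRealised_holds Γ₁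
                (U.cup2C (U.pms F ι₁ V Γ₁) 1 ω₁ ω₂),
              S.t34.ϑ χ Φ⟫_ℂ ≠ 0 →
              ∃ (Γ : Level V) (ω : Fin 4 → U.CohC (U.pms F ι₁ V Γ) 1),
                (∀ i, ω i ∈ U.Uiso Γ F (f.psi i) ι₁) ∧
                  ⟪embOf exists_isReal_hodgeModel_holds hodgePQ_independent_of_hodgeModel_holds hU cmAbelianVarietyRealised_holds Γ
                      (U.cup2C (U.pms F ι₁ V Γ) 1 (ω 2) (ω 3)),
                    embOf exists_isReal_hodgeModel_holds hodgePQ_independent_of_hodgeModel_holds hU cmAbelianVarietyRealised_holds Γ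
                      (U.cup2C (U.pms F ι₁ V Γ) 1 (ω 0) (ω 1))⟫_ℂ
                    ≠ 0)) →
    HC_CM :=
  fun hS hM ↦ hc_cm_of_supply_of_settingMeetSat_embOf _ _ _ _ deligneMilne1982_Thm_6_20_full_holds hS hM

#print axioms periodNV_of_settingMeet_embOf
#print axioms hc_cm_of_settingMeet_embOf
#print axioms hc_cm_of_exists_supply_of_settingMeetSat_embOf
#print axioms hc_cm_of_supply_of_settingMeetSat_embOf
#print axioms hc_cm_of_supply_of_settingMeetSat_embOf_rec

end Model

end Summit.HodgeConjecture.CorCM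

end
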